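import Summits.Langlands.Langlands.Theorems.SqrtFiveQuarticCoversE7DescentWLocal
import Mathlib.Data.Int.Lemmas

/-!
# Route `Langlands/SqrtFiveQuarticCovers`, sheet 4.5 row 8 — `49a4(ℚ) ≅ ℤ/2` IN THE KERNEL

`W : y² = x(x² + 294x − 343) = x³ + 294x² − 343x` is Cremona's `49a4` = LMFDB `49.a1` (minimal
model `[1,−1,0,−1822,30393]`, typ-1's anchor `e7_W_variableChange_49a4`).  MAIN THEOREM
`W_ratPoints : ∀ X Y : ℚ, Y² = X³ + 294X² − 343X → X = 0` — the named input `hQ` of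
`…CertB3E7MordellWeilQ.lean` (p677449) becomes a theorem: `W(ℚ) = {O, (0,0)}`.

PROOF SKELETON (complete 2-isogeny descent + Fermat descent on the numerator; no Mordell–Weil,
no heights, no group law — eng-8 g3 E7-MW-FERMAT, lead GO 23:34:25Z):
1. CLASS (`W_sq_or_transl_sq`, module `…WLocal`): an affine point with `x ≠ 0` has `x = r²`
   («class 1») or `−343/x = r²` (class of `T`; then the translate `(−343/x, 343y/x²)` is class 1).
2. HALVING (`W_descent_step`): a class-1 point `x = M²/e²` (`gcd(M,e) = 1`, `N² = M⁴ + 294M²e²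
   − 343e⁴`) is `ψ(Q)`, `Q = (X, 2wX) ∈ W'(ℚ)`, `X = 294 + 2w² + 2y/w ≠ 0` (`descent_psi_halve`);
   `X` or `87808/X` is a square `R²` (`Wp_sq_or_transl_sq`), and `x_ψ` is translation invariant;
   the point `(R², ·)` is `φ(P₁)`, `P₁ = (x₁, R x₁) ∈ W(ℚ)`, `x₁ ≠ 0` (`descent_phi_halve`); `x₁` or
   `−343/x₁` is a square (step 1 again) with lowest-terms triple `(M₁, e₁, N₁)`, COPRIME by
   construction (`descent_triple_of_sq`); and `x = x_ψ(x_φ(M₁²/e₁²)) =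
   ((M₁⁴ + 343e₁⁴)/(2M₁N₁e₁))²` (`W_xpsi_xphi`).
3. THE ONE INEQUALITY: hence `M·(2M₁|N₁|e₁) = e·(M₁⁴ + 343e₁⁴)`; `gcd(M,e) = 1` gives
   `M₁⁴ + 343e₁⁴ = M·g` with `g ∣ 2M₁e₁|N₁|`, and `W_gcd_bound`: such `g` divides `2744 = 2³7³`
   (two Bezout identities put `g ∣ 2⁸7⁶`; `16 ∤ M₁⁴ + 343e₁⁴` and `7⁴ ∤ M₁⁴ + 343e₁⁴` for coprime
   `(M₁, e₁)` trim the exponents).  So `M₁⁴ + 343e₁⁴ ≤ 2744·M`.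
4. FERMAT (`W_no_classOne`): strong induction on `M`; if `M₁ < M` recurse, else
   `M⁴ + 343 ≤ 2744M`, i.e. `M ≤ 13`, and `e < M`; the `13 × 12` candidates are excluded by
   `norm_num`'s `IsSquare` extension (`W_finite_check`).

HONEST STATUS: an elementary, kernel-checked determination of `E(ℚ)` for ONE explicit elliptic curve
(Cremona's Table 1 entry `49a4: r = 0, |T| = 2`, now a Lean theorem); not a modularity or BSD
statement; nothing here proves modularity of a new class.  References: Silverman–Tate III.4–III.6
(descent via 2-isogeny); Cremona 1997 Table 1; kit j319940/j320107/j320342.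
-/

set_option linter.dupNamespace false -- project-wide option; `Summit.Langlands.Langlands` is the mandated namespace

namespace Summit.Langlands.Langlands.Theorems.SqrtFiveQuarticCovers

/-! ### §1 The gcd bound `g ∣ 2744` -/

/-- Bezout identity eliminating `M`: `U·A + V·C = 2⁸7⁶·e⁹`, `A = M⁴ + 343e⁴`,
`C = 2Me(M⁴ + 294M²e² − 343e⁴)`. [folklore] -/
theorem W_bezout_e (M e : ℤ) :
    (87808 * e ^ 5 - 294 * M ^ 2 * e ^ 3 - 2 * M ^ 4 * e) * (M ^ 4 + 343 * e ^ 4)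
      + (M ^ 3 - 147 * M * e ^ 2) * (2 * M * e * (M ^ 4 + 294 * M ^ 2 * e ^ 2 - 343 * e ^ 4))
      = 30118144 * e ^ 9 := by
  ring

/-- Bezout identity eliminating `e`: `U'·A + V'·C = 2⁸·M⁹`. [folklore] -/
theorem W_bezout_M (M e : ℤ) :
    (256 * M ^ 5 + 294 * M ^ 3 * e ^ 2 - 686 * M * e ^ 4) * (M ^ 4 + 343 * e ^ 4)
      + (-343 * e ^ 3 - 147 * M ^ 2 * e) * (2 * M * e * (M ^ 4 + 294 * M ^ 2 * e ^ 2 - 343 * e ^ 4))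
      = 256 * M ^ 9 := by
  ring

/-- `16 ∤ M⁴ + 343e⁴` for coprime `(M, e)` (both odd ⇒ `≡ 8 mod 16`; else odd). [folklore] -/
theorem W_sixteen_not_dvd {M e : ℕ} (hcop : Nat.Coprime M e) : ¬ 16 ∣ M ^ 4 + 343 * e ^ 4 := by
  intro h16
  have key : ∀ m f : ZMod 16, m ^ 4 + 343 * f ^ 4 = 0 → (8 : ZMod 16) * m = 0 ∧ (8 : ZMod 16) * f = 0 := by
    decide
  have hc : ((M : ℤ) : ZMod 16) ^ 4 + 343 * ((e : ℤ) : ZMod 16) ^ 4 = 0 := by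
    have h : ((16 : ℕ) : ℤ) ∣ ((M ^ 4 + 343 * e ^ 4 : ℕ) : ℤ) := by exact_mod_cast h16
    have := (ZMod.intCast_zmod_eq_zero_iff_dvd _ 16).mpr h
    push_cast at this ⊢
    exact this
  obtain ⟨hM, hE⟩ := key _ _ hc
  have h2 : 2 ∣ Nat.gcd M e :=
    Nat.dvd_gcd (by exact_mod_cast two_dvd_of_zmod16 hM) (by exact_mod_cast two_dvd_of_zmod16 hE)
  rw [Nat.Coprime.gcd_eq_one hcop] at h2
  omega

/-- `7⁴ ∤ M⁴ + 343e⁴` for coprime `(M, e)` (`7 ∣ M` would force `7 ∣ e`). [folklore] -/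
theorem W_seven_pow_four_not_dvd {M e : ℕ} (hcop : Nat.Coprime M e) : ¬ 7 ^ 4 ∣ M ^ 4 + 343 * e ^ 4 := by
  intro h
  have h7A : 7 ∣ M ^ 4 + 343 * e ^ 4 := (dvd_pow_self 7 (by norm_num)).trans h
  have h7M4 : 7 ∣ M ^ 4 :=
    (Nat.dvd_add_left (dvd_mul_of_dvd_left (by norm_num : 7 ∣ 343) _)).mp h7A
  have h7M : 7 ∣ M := (Nat.prime_seven.dvd_of_dvd_pow) h7M4
  obtain ⟨M', rfl⟩ := h7M
  have h' : 7 ^ 4 ∣ 343 * e ^ 4 := by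
    have : 7 ^ 4 ∣ (7 * M') ^ 4 := ⟨M' ^ 4, by ring⟩
    exact (Nat.dvd_add_right this).mp h
  have h7e4 : 7 ∣ e ^ 4 := by
    have : 343 * 7 ∣ 343 * e ^ 4 := by norm_num at h' ⊢; exact h'
    exact Nat.dvd_of_mul_dvd_mul_left (by norm_num) this
  have h7e : 7 ∣ e := Nat.prime_seven.dvd_of_dvd_pow h7e4
  have : 7 ∣ Nat.gcd (7 * M') e := Nat.dvd_gcd (dvd_mul_right 7 M') h7e
  rw [Nat.Coprime.gcd_eq_one hcop] at this
  omega

/-- **The gcd bound.**  For coprime `(M, e)` with `N² = M⁴ + 294M²e² − 343e⁴`, every common divisor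
`g` of `A = M⁴ + 343e⁴` and `2Me|N|` divides `2744 = 2³7³`. [folklore] -/
theorem W_gcd_bound {M e : ℕ} {N : ℤ} (hcop : Nat.Coprime M e)
    (hN : N ^ 2 = (M : ℤ) ^ 4 + 294 * M ^ 2 * e ^ 2 - 343 * e ^ 4)
    {g : ℕ} (hgA : g ∣ M ^ 4 + 343 * e ^ 4) (hgB : g ∣ 2 * M * e * N.natAbs) : g ∣ 2744 := by
  have hgA' : (g : ℤ) ∣ (M : ℤ) ^ 4 + 343 * e ^ 4 := by exact_mod_cast hgA
  have hgC : (g : ℤ) ∣ 2 * M * e * ((M : ℤ) ^ 4 + 294 * M ^ 2 * e ^ 2 - 343 * e ^ 4) := by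
    have h1 : (g : ℤ) ∣ 2 * M * e * (N.natAbs : ℤ) := by exact_mod_cast hgB
    rw [← hN]
    exact h1.trans (mul_dvd_mul_left _ (Int.natAbs_dvd.mpr (dvd_pow_self N two_ne_zero)))
  have h1 : (g : ℤ) ∣ 30118144 * (e : ℤ) ^ 9 := by
    rw [← W_bezout_e]
    exact dvd_add (dvd_mul_of_dvd_right hgA' _) (dvd_mul_of_dvd_right hgC _)
  have h2 : (g : ℤ) ∣ 30118144 * (M : ℤ) ^ 9 := by
    have : (g : ℤ) ∣ 256 * (M : ℤ) ^ 9 := by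
      rw [← W_bezout_M]
      exact dvd_add (dvd_mul_of_dvd_right hgA' _) (dvd_mul_of_dvd_right hgC _)
    rw [show (30118144 : ℤ) * (M : ℤ) ^ 9 = 117649 * (256 * (M : ℤ) ^ 9) by ring]
    exact dvd_mul_of_dvd_right this _
  have h1N : g ∣ 30118144 * e ^ 9 := by exact_mod_cast h1
  have h2N : g ∣ 30118144 * M ^ 9 := by exact_mod_cast h2
  have hR : g ∣ 2 ^ 8 * 7 ^ 6 := by
    have := Nat.dvd_gcd h1N h2N
    rwa [Nat.gcd_mul_left, Nat.Coprime.gcd_eq_one (Nat.Coprime.pow 9 9 hcop.symm), mul_one] at this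
  have hsplit : g = Nat.gcd g (2 ^ 8) * Nat.gcd g (7 ^ 6) := by
    rw [← Nat.Coprime.gcd_mul g (by norm_num : Nat.Coprime (2 ^ 8) (7 ^ 6)), Nat.gcd_eq_left hR]
  obtain ⟨i, hi, hgi⟩ := (Nat.dvd_prime_pow Nat.prime_two).mp (Nat.gcd_dvd_right g (2 ^ 8))
  obtain ⟨j, hj, hgj⟩ := (Nat.dvd_prime_pow Nat.prime_seven).mp (Nat.gcd_dvd_right g (7 ^ 6))
  rw [hgi, hgj] at hsplit
  have hi3 : i ≤ 3 := by
    by_contra hi3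
    apply W_sixteen_not_dvd hcop
    refine dvd_trans ?_ hgA
    rw [hsplit]
    have h4i : 4 ≤ i := by omega
    have : 2 ^ 4 ∣ 2 ^ i := Nat.pow_dvd_pow 2 h4i
    exact dvd_mul_of_dvd_left (by norm_num at this; exact this) _
  have hj3 : j ≤ 3 := by
    by_contra hj3
    apply W_seven_pow_four_not_dvd hcop
    refine dvd_trans ?_ hgA
    rw [hsplit]
    have h4j : 4 ≤ j := by omega
    exact dvd_mul_of_dvd_right (Nat.pow_dvd_pow 7 h4j) _
  rw [hsplit, show (2744 : ℕ) = 2 ^ 3 * 7 ^ 3 by norm_num]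
  exact Nat.mul_dvd_mul (Nat.pow_dvd_pow 2 hi3) (Nat.pow_dvd_pow 7 hj3)

/-! ### §2 The descent step -/

/-- `x_ψ ∘ x_φ` on `W`: `= (t² + 343)²/(4t(t² + 294t − 343))` (the `x`-coordinate of `2P`).
[folklore] -/
theorem W_xpsi_xphi (t : ℚ) (ht : t ≠ 0) :
    (((t ^ 2 + 294 * t - 343) / t) ^ 2 - 588 * ((t ^ 2 + 294 * t - 343) / t) + 87808)
        / (4 * ((t ^ 2 + 294 * t - 343) / t))
      = (t ^ 2 + 343) ^ 2 / (4 * (t * (t ^ 2 + 294 * t - 343))) := by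
  field_simp
  ring

/-- **Halving, normalised.**  From a class-1 point through `ψ` and `φ` back to a class-1 point:
given `x = w² ≠ 0` on `W` there are `xh = rh² ≠ 0`, `yh` on `W` with
`x = (xh² + 343)²/(4·xh·(xh² + 294xh − 343))` and `xh² + 294xh − 343 ≠ 0`. [folklore] -/
theorem W_halve {x y w : ℚ} (hxw : x = w ^ 2) (hw : w ≠ 0)
    (hy : y ^ 2 = x * (x ^ 2 + 294 * x - 343)) :
    ∃ xh yh rh : ℚ, rh ≠ 0 ∧ xh = rh ^ 2 ∧ yh ^ 2 = xh * (xh ^ 2 + 294 * xh - 343) ∧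
      xh ^ 2 + 294 * xh - 343 ≠ 0 ∧ x = (xh ^ 2 + 343) ^ 2 / (4 * (xh * (xh ^ 2 + 294 * xh - 343))) := by
  have hyc : y ^ 2 = x * (x ^ 2 + (294 : ℚ) * x + (-343 : ℚ)) := by linear_combination hy
  obtain ⟨hX0, hYc, hxψ⟩ :=
    descent_psi_halve (a := (294 : ℚ)) (b := (-343 : ℚ)) (by norm_num) hxw hw hyc
  set X : ℚ := 294 + 2 * w ^ 2 + 2 * (y / w) with hXdef
  have hYc' : (2 * w * X) ^ 2 = X * (X ^ 2 - 588 * X + 87808) := by rw [hYc]; ring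
  have hxψ' : (X ^ 2 - 588 * X + 87808) / (4 * X) = x := by rw [← hxψ]; ring
  -- (Xh, Yh) := (X, 2wX) or its translate by T', with Xh a nonzero square
  obtain ⟨Xh, Yh, Rh, hRh, hXh, hYh, hψh⟩ : ∃ Xh Yh Rh : ℚ, Rh ≠ 0 ∧ Xh = Rh ^ 2 ∧
      Yh ^ 2 = Xh * (Xh ^ 2 - 588 * Xh + 87808) ∧ (Xh ^ 2 - 588 * Xh + 87808) / (4 * Xh) = x := by
    rcases Wp_sq_or_transl_sq hX0 hYc' with ⟨R, hR0, hXR⟩ | ⟨R, hR0, hXR⟩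
    · exact ⟨X, 2 * w * X, R, hR0, hXR, hYc', hxψ'⟩
    · refine ⟨87808 / X, 87808 * (2 * w * X) / X ^ 2, R, hR0, hXR, ?_, ?_⟩
      · have h := descent_transl_onCurve (-588 : ℚ) 87808 hX0 (y := 2 * w * X) (by rw [hYc']; ring)
        rw [h]; ring
      · rw [← hxψ']
        field_simp
        ring
  have hXh0 : Xh ≠ 0 := by rw [hXh]; exact pow_ne_zero 2 hRh
  -- φ-halving
  have hYh' : Yh ^ 2 = Xh * (Xh ^ 2 - 2 * (294 : ℚ) * Xh + ((294 : ℚ) ^ 2 - 4 * (-343 : ℚ))) := by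
    rw [hYh]; ring
  obtain ⟨hx1, hy1, hφ1⟩ := descent_phi_halve (a := (294 : ℚ)) (b := (-343 : ℚ)) (by norm_num) hXh hRh hYh'
  set x₁ : ℚ := (Rh ^ 2 - 294 + Yh / Rh) / 2 with hx₁def
  have hy1' : (Rh * x₁) ^ 2 = x₁ * (x₁ ^ 2 + 294 * x₁ - 343) := by rw [hy1]; ring
  have hφ1' : (x₁ ^ 2 + 294 * x₁ - 343) / x₁ = Xh := by rw [← hφ1]; ring
  -- (xh, yh) := (x₁, Rh x₁) or its translate by T, with xh a nonzero square
  obtain ⟨xh, yh, rh, hrh, hxh, hyh, hφh⟩ : ∃ xh yh rh : ℚ, rh ≠ 0 ∧ xh = rh ^ 2 ∧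
      yh ^ 2 = xh * (xh ^ 2 + 294 * xh - 343) ∧ (xh ^ 2 + 294 * xh - 343) / xh = Xh := by
    rcases W_sq_or_transl_sq hx1 hy1' with ⟨r, hr0, hxr⟩ | ⟨r, hr0, hxr⟩
    · exact ⟨x₁, Rh * x₁, r, hr0, hxr, hy1', hφ1'⟩
    · refine ⟨-343 / x₁, -343 * (Rh * x₁) / x₁ ^ 2, r, hr0, hxr, ?_, ?_⟩
      · have h := descent_transl_onCurve (294 : ℚ) (-343) hx1 (y := Rh * x₁) (by rw [hy1']; ring)
        rw [h]; ring
      · rw [← hφ1']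
        field_simp
        ring
  have hxh0 : xh ≠ 0 := by rw [hxh]; exact pow_ne_zero 2 hrh
  have hq0 : xh ^ 2 + 294 * xh - 343 ≠ 0 := by
    intro h0
    apply hXh0
    rw [← hφh, h0, zero_div]
  refine ⟨xh, yh, rh, hrh, hxh, hyh, hq0, ?_⟩
  rw [← hψh, ← hφh, W_xpsi_xphi xh hxh0]

/-- **The descent step with the height inequality.**  A class-1 triple `(M, e, N)` — `x = M²/e²`
on `W` in lowest terms, `N² = M⁴ + 294M²e² − 343e⁴` — yields a class-1 triple `(M₁, e₁, N₁)` with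
`M₁⁴ + 343e₁⁴ ≤ 2744·M`. [folklore] -/
theorem W_descent_step {M e : ℕ} {N : ℤ} (hM : 0 < M) (he : 0 < e) (hcop : Nat.Coprime M e)
    (hN : N ^ 2 = (M : ℤ) ^ 4 + 294 * M ^ 2 * e ^ 2 - 343 * e ^ 4) :
    ∃ (M₁ e₁ : ℕ) (N₁ : ℤ), 0 < M₁ ∧ 0 < e₁ ∧ Nat.Coprime M₁ e₁ ∧
      N₁ ^ 2 = (M₁ : ℤ) ^ 4 + 294 * M₁ ^ 2 * e₁ ^ 2 - 343 * e₁ ^ 4 ∧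
      M₁ ^ 4 + 343 * e₁ ^ 4 ≤ 2744 * M := by
  have hMQ : (M : ℚ) ≠ 0 := by positivity
  have heQ : (e : ℚ) ≠ 0 := by positivity
  have hNQ : ((N : ℚ)) ^ 2 = (M : ℚ) ^ 4 + 294 * (M : ℚ) ^ 2 * (e : ℚ) ^ 2 - 343 * (e : ℚ) ^ 4 := by
    exact_mod_cast hN
  -- the rational point `(x, y) = (M²/e², M N/e³)`
  have hxw : (M : ℚ) ^ 2 / (e : ℚ) ^ 2 = ((M : ℚ) / e) ^ 2 := by rw [div_pow]
  have hyc : ((M : ℚ) * N / (e : ℚ) ^ 3) ^ 2 =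
      ((M : ℚ) ^ 2 / (e : ℚ) ^ 2) * (((M : ℚ) ^ 2 / (e : ℚ) ^ 2) ^ 2 + 294 * ((M : ℚ) ^ 2 / (e : ℚ) ^ 2) - 343) := by
    rw [div_pow, mul_pow, hNQ]
    field_simp
  obtain ⟨xh, yh, rh, hrh, hxh, hyh, hq0, hxrel⟩ := W_halve hxw (div_ne_zero hMQ heQ) hyc
  -- the lowest-terms triple of `xh`
  have hyh' : yh ^ 2 = xh * (xh ^ 2 + ((294 : ℤ) : ℚ) * xh + ((-343 : ℤ) : ℚ)) := by
    push_cast; linear_combination hyh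
  obtain ⟨M₁, e₁, N₁, hM₁, he₁, hcop₁, hxh₁, hN₁⟩ := descent_triple_of_sq hrh hxh hyh'
  have hN₁' : N₁ ^ 2 = (M₁ : ℤ) ^ 4 + 294 * M₁ ^ 2 * e₁ ^ 2 - 343 * e₁ ^ 4 := by linear_combination hN₁
  refine ⟨M₁, e₁, N₁, hM₁, he₁, hcop₁, hN₁', ?_⟩
  have hM₁Q : (M₁ : ℚ) ≠ 0 := by positivity
  have he₁Q : (e₁ : ℚ) ≠ 0 := by positivity
  have hN₁Q : ((N₁ : ℚ)) ^ 2 = (M₁ : ℚ) ^ 4 + 294 * (M₁ : ℚ) ^ 2 * (e₁ : ℚ) ^ 2 - 343 * (e₁ : ℚ) ^ 4 := by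
    exact_mod_cast hN₁'
  -- `N₁ ≠ 0`
  have hN₁0 : (N₁ : ℚ) ≠ 0 := by
    intro h0
    apply hq0
    rw [hxh₁]
    field_simp
    have : (M₁ : ℚ) ^ 4 + 294 * (M₁ : ℚ) ^ 2 * (e₁ : ℚ) ^ 2 - 343 * (e₁ : ℚ) ^ 4 = 0 := by
      rw [← hN₁Q, h0]; ring
    linear_combination this
  -- the key relation `x · (2 M₁ N₁ e₁)² = (M₁⁴ + 343 e₁⁴)²`
  have hq : xh * (xh ^ 2 + 294 * xh - 343) = (M₁ : ℚ) ^ 2 * (N₁ : ℚ) ^ 2 / (e₁ : ℚ) ^ 6 := by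
    rw [hxh₁, hN₁Q]
    field_simp
  have hnum : xh ^ 2 + 343 = ((M₁ : ℚ) ^ 4 + 343 * (e₁ : ℚ) ^ 4) / (e₁ : ℚ) ^ 4 := by
    rw [hxh₁]
    field_simp
  have hkey : ((M : ℚ) ^ 2 / (e : ℚ) ^ 2) * (2 * (M₁ : ℚ) * N₁ * e₁) ^ 2
      = ((M₁ : ℚ) ^ 4 + 343 * (e₁ : ℚ) ^ 4) ^ 2 := by
    rw [hxrel, hq, hnum]
    field_simp
    ring
  -- in integers: `(M · 2M₁N₁e₁)² = (e · (M₁⁴ + 343e₁⁴))²`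
  have hQ2 : ((M : ℚ) * (2 * (M₁ : ℚ) * N₁ * e₁)) ^ 2 = ((e : ℚ) * ((M₁ : ℚ) ^ 4 + 343 * (e₁ : ℚ) ^ 4)) ^ 2 := by
    have h0 : ((M : ℚ) * (2 * (M₁ : ℚ) * N₁ * e₁)) ^ 2
        = (e : ℚ) ^ 2 * ((M : ℚ) ^ 2 / (e : ℚ) ^ 2 * (2 * (M₁ : ℚ) * N₁ * e₁) ^ 2) := by
      field_simp
    rw [h0, hkey]
    ring
  have hZ : ((M : ℤ) * (2 * M₁ * N₁ * e₁)) ^ 2 = ((e : ℤ) * ((M₁ : ℤ) ^ 4 + 343 * e₁ ^ 4)) ^ 2 := by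
    exact_mod_cast hQ2
  have hNat : M * (2 * M₁ * e₁ * N₁.natAbs) = e * (M₁ ^ 4 + 343 * e₁ ^ 4) := by
    have h1 := Int.natAbs_eq_iff_sq_eq.mpr hZ
    have h2 : ((M : ℤ) * (2 * M₁ * N₁ * e₁)).natAbs = M * (2 * M₁ * e₁ * N₁.natAbs) := by
      rw [show (M : ℤ) * (2 * M₁ * N₁ * e₁) = ((M * (2 * M₁ * e₁) : ℕ) : ℤ) * N₁ by push_cast; ring,
        Int.natAbs_mul, Int.natAbs_natCast]
      ring
    have h3 : ((e : ℤ) * ((M₁ : ℤ) ^ 4 + 343 * e₁ ^ 4)).natAbs = e * (M₁ ^ 4 + 343 * e₁ ^ 4) := by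
      rw [show (e : ℤ) * ((M₁ : ℤ) ^ 4 + 343 * e₁ ^ 4) = ((e * (M₁ ^ 4 + 343 * e₁ ^ 4) : ℕ) : ℤ) by
        push_cast; ring, Int.natAbs_natCast]
    rw [h2, h3] at h1
    exact h1
  -- `M ∣ A₁`, `A₁ = M g`, `g ∣ 2 M₁ e₁ |N₁|`
  have hMA : M ∣ M₁ ^ 4 + 343 * e₁ ^ 4 :=
    hcop.dvd_of_dvd_mul_left ⟨2 * M₁ * e₁ * N₁.natAbs, hNat.symm⟩
  obtain ⟨g, hg⟩ := hMA
  have hgB : g ∣ 2 * M₁ * e₁ * N₁.natAbs := by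
    refine ⟨e, ?_⟩
    have : M * (2 * M₁ * e₁ * N₁.natAbs) = M * (g * e) := by rw [hNat, hg]; ring
    exact Nat.eq_of_mul_eq_mul_left hM this
  have hg2744 : g ∣ 2744 := W_gcd_bound hcop₁ hN₁' ⟨M, by rw [hg]; ring⟩ hgB
  have hgle : g ≤ 2744 := Nat.le_of_dvd (by norm_num) hg2744
  calc M₁ ^ 4 + 343 * e₁ ^ 4 = M * g := hg
    _ ≤ M * 2744 := Nat.mul_le_mul_left M hgle
    _ = 2744 * M := by ring

/-! ### §3 Fermat's descent and the finite check -/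

/-- The finite check: for `1 ≤ M ≤ 13`, `1 ≤ e ≤ 12`, `M⁴ + 294M²e² − 343e⁴` is not a perfect
square (`norm_num`'s `IsSquare` extension, 156 evaluations). [folklore] -/
theorem W_finite_check : ∀ M e : ℕ, M ≤ 13 → e ≤ 12 → 0 < M → 0 < e →
    ¬ IsSquare ((M : ℤ) ^ 4 + 294 * M ^ 2 * e ^ 2 - 343 * e ^ 4) := by
  intro M e hM he hM0 he0
  interval_cases M <;> interval_cases e <;> norm_num

/-- **No class-1 points on `W` (Fermat descent on the numerator `M`).** [folklore] -/
theorem W_no_classOne : ∀ (M e : ℕ) (N : ℤ), 0 < M → 0 < e → Nat.Coprime M e →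
    N ^ 2 = (M : ℤ) ^ 4 + 294 * M ^ 2 * e ^ 2 - 343 * e ^ 4 → False := by
  intro M
  induction M using Nat.strong_induction_on with
  | _ M ih =>
    intro e N hM he hcop hN
    obtain ⟨M₁, e₁, N₁, hM₁, he₁, hcop₁, hN₁, hle⟩ := W_descent_step hM he hcop hN
    by_cases hlt : M₁ < M
    · exact ih M₁ hlt e₁ N₁ hM₁ he₁ hcop₁ hN₁
    · -- `M ≤ M₁`: `M⁴ + 343 ≤ M₁⁴ + 343e₁⁴ ≤ 2744M`, so `M ≤ 13`
      have hMM : M ≤ M₁ := not_lt.mp hlt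
      have hM4 : M ^ 4 + 343 ≤ 2744 * M := by
        have h1 : M ^ 4 ≤ M₁ ^ 4 := Nat.pow_le_pow_left hMM 4
        have h2 : 343 ≤ 343 * e₁ ^ 4 := Nat.le_mul_of_pos_right _ (by positivity)
        omega
      have hM13 : M ≤ 13 := by
        by_contra h
        have h14 : 14 ≤ M := by omega
        have : 2744 * M ≤ M ^ 4 := by
          calc 2744 * M = 14 ^ 3 * M := by norm_num
            _ ≤ M ^ 3 * M := Nat.mul_le_mul_right M (Nat.pow_le_pow_left h14 3)
            _ = M ^ 4 := by ring
        omega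
      -- `e < M` from `N² ≥ 0`
      have he12 : e ≤ 12 := by
        by_contra h
        have heM : M ≤ e := by omega
        have h1 : (M : ℤ) ^ 4 ≤ (e : ℤ) ^ 4 := by exact_mod_cast Nat.pow_le_pow_left heM 4
        have h2 : (M : ℤ) ^ 2 ≤ (e : ℤ) ^ 2 := by exact_mod_cast Nat.pow_le_pow_left heM 2
        have h3 : (0 : ℤ) ≤ N ^ 2 := sq_nonneg N
        have h4 : (0 : ℤ) < (e : ℤ) ^ 4 := by positivity
        nlinarith
      exact W_finite_check M e hM13 he12 hM he ⟨N, by rw [← sq]; exact hN.symm⟩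

/-! ### §4 `W(ℚ) = {O, T}` -/

/-- **`49a4(ℚ)_aff = {(0,0)}`: every rational affine point of `Y² = X³ + 294X² − 343X` has
`X = 0`** — the named input `hQ` of `…CertB3E7MordellWeilQ.lean` as a THEOREM (Cremona's Table 1,
`49a4: r = 0, |T| = 2`, = LMFDB `49.a1`).  Class of the point (`W_sq_or_transl_sq`), translate the
class of `T` to class `1`, lowest-terms triple, `W_no_classOne`. [cite: Cremona1997, Table 1 (N = 49, curve A4)] -/
theorem W_ratPoints : ∀ X Y : ℚ, Y ^ 2 = X ^ 3 + 294 * X ^ 2 - 343 * X → X = 0 := by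
  intro x y h
  by_contra hx
  have hy : y ^ 2 = x * (x ^ 2 + 294 * x - 343) := by linear_combination h
  -- a class-1 point `(xh, yh)` with `xh = r²`
  obtain ⟨xh, yh, r, hr, hxr, hyh⟩ : ∃ xh yh r : ℚ, r ≠ 0 ∧ xh = r ^ 2 ∧
      yh ^ 2 = xh * (xh ^ 2 + 294 * xh - 343) := by
    rcases W_sq_or_transl_sq hx hy with ⟨r, hr, hxr⟩ | ⟨r, hr, hxr⟩
    · exact ⟨x, y, r, hr, hxr, hy⟩
    · refine ⟨-343 / x, -343 * y / x ^ 2, r, hr, hxr, ?_⟩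
      have := descent_transl_onCurve (294 : ℚ) (-343) hx (y := y) (by rw [hy]; ring)
      rw [this]; ring
  have hyh' : yh ^ 2 = xh * (xh ^ 2 + ((294 : ℤ) : ℚ) * xh + ((-343 : ℤ) : ℚ)) := by
    push_cast; linear_combination hyh
  obtain ⟨M, e, N, hM, he, hcop, -, hN⟩ := descent_triple_of_sq hr hxr hyh'
  exact W_no_classOne M e N hM he hcop (by linear_combination hN)

end Summit.Langlands.Langlands.Theorems.SqrtFiveQuarticCovers
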